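import Literature.NumberTheory.QuadraticForms.HilbertSymbolNormCompatParity
import Literature.NumberTheory.QuadraticForms.LocalNormProductSquares
import Literature.NumberTheory.QuadraticForms.HilbertSymbolOddPlaceNormProduct
import Literature.NumberTheory.QuadraticForms.LocalSquareClassApproximation
import Literature.NumberTheory.QuadraticForms.HilbertSymbolBilinear
import Literature.NumberTheory.QuadraticForms.HilbertSymbolUnramified
import Literature.NumberTheory.QuadraticForms.PadicSquares
import Literature.NumberTheory.AdelicBaseChange.CompletionBaseChange
import Literature.NumberTheory.GaloisRepresentations.PadicAlgebraOfLocalField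
import Mathlib.NumberTheory.Padics.HeightOneSpectrum
import HarnessLib

/-!
# The projection formula `(a, b)_{F_𝔭} = (a, N_{F_𝔭/ℚ₂} b)_{ℚ₂}` for COMPLETIONS of number fields at dyadic places
# — the global road (Hilbert reciprocity), no local class field theory

Topic `NumberTheory/QuadraticForms`; namespace `Literature.NumberTheory.QuadraticForms`; a *proofs* file
(theorems only).  Cell `hodgecm-mathlib`, row III-11c: the only consumer of the printed residual
`HilbertSymbolNormCompatAtTwo` (`HilbertSymbolNormCompat.lean`: Neukirch IV (6.4) with V (3.1)–(3.2), local
class field theory) instantiates it at a completion `F_𝔭` (`𝔭 ∣ 2`) of a number field with its canonical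
`ℚ₂`-algebra structure `LocalField.adicCompletionPadicAlgebra`; for such `K = F_𝔭` the formula is proved here
from theorems of the tree: Hilbert's reciprocity law over `F` and over `ℚ` (O'Meara 71:18,
`hilbertReciprocity_holds`) compared fibrewise (`prod_hilbertSymbol_two_eq_of_forall_odd`), the odd-place
identity `∏_{w∣p} (a, β)_w = (a, N β)_p` (63:11a/63:12, `prod_hilbertSymbol_natCast_eq_of_not_dvd`), the
approximation of the local square class of `b` by a global `β` that is a local square at finitely many other
places (`exists_isSquare_mul_algebraMap_and_forall_isSquare`), the norm packet
`N_{F/ℚ} β = ∏_{w∣v} N_{F_w/ℚ_v} β` (Cassels–Fröhlich II (19.19), `algebraMap_adicCompletion_norm_eq_prod`), the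
bimultiplicativity of the local symbol at every place (63:13a, `hilbertSymbol_adicCompletion_mul_left`) and the
`2`-adic square classes (`padic_exists_intCast_mul_sq`).

* `hilbertSymbol_natPrime_eq_hilbertSymbol_norm` — the formula for `a = q` a rational prime (the global step);
* `hilbertSymbol_intCast_eq_hilbertSymbol_norm` — for every non-zero integer `a` (multiplicativity; `-1 ~ 7`);
* `hilbertSymbol_normCompat_adicCompletion_two` — **the projection formula in the consumer's currency**:
  `(a, b)_{F_𝔭} = (a, N_{F_𝔭/ℚ₂} b)_{ℚ₂}` for `a ∈ ℚ₂ˣ`, `b ∈ F_𝔭ˣ`, `ℚ₂ = ℚ_[2]` (Mathlib `Padic`) acting through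
  `LocalField.adicCompletionPadicAlgebra 𝔭 2 h2`.

The abstract statement for an arbitrary finite extension `K/ℚ₂` (`HilbertSymbolNormCompatAtTwo`) is NOT claimed
(it would need «every such `K` is a completion of a number field»).

## References
* [Omeara1963] O. T. O'Meara, *Introduction to quadratic forms* (1963), §63B (63:11a, 63:12, 63:13a), §71 Thm. 71:18.
* [NeukirchANT1999] J. Neukirch, *Algebraic Number Theory* (1999), Ch. IV (6.4), Ch. V (3.1)–(3.2) (the statement),
  Ch. VI (5.7) (the global proof of the local norm functoriality).
* [CasselsFrohlichANT1967] Cassels–Fröhlich, *Algebraic Number Theory* (1967), Ch. II §10 (10.2), §19 (19.19), (19.22).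
-/

noncomputable section

open scoped Classical
open NumberField IsDedekindDomain IsDedekindDomain.HeightOneSpectrum
open Literature.NumberTheory.GaloisRepresentations (LocalField.adicCompletionPadicAlgebra
  LocalField.eq_algebraMap_adicCompletionPadicAlgebra)

namespace Literature.NumberTheory.QuadraticForms

/-! ### §0 Places of `ℚ`: the generator prime of a finite place -/

/-- The rational prime `p_v = natGenerator v` of a finite place `v` of `ℚ` lies in `v`: `(p_v) = v ∩ ℤ`
(Mathlib `Rat.HeightOneSpectrum.span_natGenerator`; private copy of the tree's
`Literature.NumberTheory.EllipticCurves.Mazur1978.natCast_natGenerator_mem_asIdeal`, whose module is too heavy to import here).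
[folklore] -/
private theorem natCast_natGenerator_mem (v : HeightOneSpectrum (𝓞 ℚ)) :
    ((Rat.HeightOneSpectrum.natGenerator v : ℕ) : 𝓞 ℚ) ∈ v.asIdeal := by
  have h := Ideal.symm_apply_mem_of_equiv_iff.2 ((Rat.HeightOneSpectrum.natGenerator_dvd_iff v).1 (dvd_refl _))
  rwa [map_natCast] at h

/-- The place `v_p = primesEquiv⁻¹ p` of `ℚ` contains `p` (private helper). [folklore] -/
private theorem natCast_mem_primesEquiv_symm (p : Nat.Primes) :
    ((p : ℕ) : 𝓞 ℚ) ∈ ((Rat.HeightOneSpectrum.primesEquiv (R := 𝓞 ℚ)).symm p).asIdeal := by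
  have h := natCast_natGenerator_mem ((Rat.HeightOneSpectrum.primesEquiv (R := 𝓞 ℚ)).symm p)
  have hgen : Rat.HeightOneSpectrum.natGenerator ((Rat.HeightOneSpectrum.primesEquiv (R := 𝓞 ℚ)).symm p) = p :=
    congrArg Subtype.val ((Rat.HeightOneSpectrum.primesEquiv (R := 𝓞 ℚ)).apply_symm_apply p)
  rwa [hgen] at h

/-- Two finite places of `ℚ` containing the same rational prime are equal (Ostrowski; Mathlib's
`Rat.HeightOneSpectrum.primesEquiv`). [cite: CasselsFrohlichANT1967, Ch. II §3 (valuations of ℚ)] -/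
private theorem rat_place_eq_of_natCast_mem {p : ℕ} (hp : p.Prime) {v v' : HeightOneSpectrum (𝓞 ℚ)}
    (hv : (p : 𝓞 ℚ) ∈ v.asIdeal) (hv' : (p : 𝓞 ℚ) ∈ v'.asIdeal) : v = v' := by
  have key : ∀ u : HeightOneSpectrum (𝓞 ℚ), (p : 𝓞 ℚ) ∈ u.asIdeal →
      Rat.HeightOneSpectrum.primesEquiv (R := 𝓞 ℚ) u = ⟨p, hp⟩ := by
    intro u hu
    have hmem : ((p : ℕ) : ℤ) ∈ u.asIdeal.map (Rat.IsIntegralClosure.intEquiv (𝓞 ℚ)) := by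
      have h := Ideal.mem_map_of_mem (Rat.IsIntegralClosure.intEquiv (𝓞 ℚ)) hu
      rwa [map_natCast] at h
    have hdvd : Rat.HeightOneSpectrum.natGenerator u ∣ p :=
      (Rat.HeightOneSpectrum.natGenerator_dvd_iff u).2 hmem
    exact Subtype.ext ((Nat.prime_dvd_prime_iff_eq (Rat.HeightOneSpectrum.prime_natGenerator u) hp).1 hdvd)
  exact (Rat.HeightOneSpectrum.primesEquiv (R := 𝓞 ℚ)).injective (by rw [key v hv, key v' hv'])

/-- In a prime `w` of `𝓞 F` above the place `v` of `ℚ`, a rational integer lying in `v` lies in `w`. [folklore] -/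
private theorem natCast_mem_of_under_eq {F : Type} [Field F] [NumberField F] {v : HeightOneSpectrum (𝓞 ℚ)}
    {w : HeightOneSpectrum (𝓞 F)} (hw : w.under (𝓞 ℚ) = v) {n : ℕ} (hn : (n : 𝓞 ℚ) ∈ v.asIdeal) :
    (n : 𝓞 F) ∈ w.asIdeal := by
  rw [← hw] at hn
  change (n : 𝓞 ℚ) ∈ Ideal.comap (algebraMap (𝓞 ℚ) (𝓞 F)) w.asIdeal at hn
  rw [Ideal.mem_comap, map_natCast] at hn
  exact hn

/-! ### §1 The global step: the projection formula for `a = q` a rational prime -/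

section Packet

variable (F : Type) [Field F] [NumberField F]
  (v₂ : HeightOneSpectrum (𝓞 ℚ)) (hv₂ : (2 : 𝓞 ℚ) ∈ v₂.asIdeal) (w₀ : v₂.Extension (𝓞 F))

/-- `-7` is a square in the completion of a number field at any dyadic place (`-7 = 1 + 4·(-2)` and
`X² - X + 2` has the root `0` modulo a dyadic prime: the split Artin–Schreier case, O'Meara §63A).
[cite: Omeara1963, §63A (units of quadratic defect 4𝔬)] -/
theorem isSquare_neg_seven_adicCompletion {K : Type} [Field K] [NumberField K] (v : HeightOneSpectrum (𝓞 K))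
    (h2 : (2 : 𝓞 K) ∈ v.asIdeal) : IsSquare (-7 : v.adicCompletion K) := by
  have h := isSquare_one_add_four_mul_adicCompletion_of_exists K v h2 (ρ := -2)
    ⟨0, by simpa using h2⟩
  have h7 : algebraMap (𝓞 K) (v.adicCompletion K) (1 + 4 * (-2)) = -7 := by
    simp only [map_add, map_one, map_mul, map_neg, map_ofNat]
    norm_num
  rwa [h7] at h

include hv₂ in
/-- **The global step.**  For a number field `F`, a dyadic place `w₀` of `F` (above the dyadic place `v₂` of
`ℚ`), a rational prime `q` and `b ∈ F_{w₀}ˣ`: `(q, b)_{F_{w₀}} = (q, N_{F_{w₀}/ℚ_{v₂}} b)_{ℚ_{v₂}}` — Hilbert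
reciprocity for `(q, β)` over `F` and `(q, N β)` over `ℚ`, `β ∈ F` a global element in the square class of `b` at
`w₀` which is a local square at the other dyadic places and at the places above `q`, together with the odd-place
identity at `p ∤ q` and the norm packet (19.19) at the places above `q` and above `2`.
[cite: Omeara1963, §71 Thm. 71:18] [cite: NeukirchANT1999, Ch. VI (5.7) with Ch. V (3.1)]
[cite: CasselsFrohlichANT1967, Ch. II §19 (19.19)] -/
theorem hilbertSymbol_natPrime_eq_hilbertSymbol_norm {q : ℕ} (hq : q.Prime)
    {b : w₀.1.adicCompletion F} (hb : b ≠ 0) :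
    hilbertSymbol (w₀.1.adicCompletion F) (q : w₀.1.adicCompletion F) b =
      hilbertSymbol (v₂.adicCompletion ℚ) (q : v₂.adicCompletion ℚ)
        (Algebra.norm (v₂.adicCompletion ℚ) b) := by
  have h2F : (2 : 𝓞 F) ∈ w₀.1.asIdeal := by exact_mod_cast natCast_mem_of_under_eq w₀.2 (n := 2) (by exact_mod_cast hv₂)
  -- the finite set `T` of places where `β` is to be a square: the places dividing `2q`, except `w₀`
  have h2q0 : Ideal.span {((2 * q : ℕ) : 𝓞 F)} ≠ ⊥ := by
    rw [Ne, Ideal.span_singleton_eq_bot]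
    exact_mod_cast (Nat.mul_ne_zero_iff.2 ⟨two_ne_zero, hq.ne_zero⟩ : 2 * q ≠ 0)
  set T : Finset (HeightOneSpectrum (𝓞 F)) := (Ideal.finite_factors h2q0).toFinset.erase w₀.1 with hTdef
  have hmemT : ∀ w : HeightOneSpectrum (𝓞 F), w ∈ T ↔ w ≠ w₀.1 ∧ ((2 * q : ℕ) : 𝓞 F) ∈ w.asIdeal := by
    intro w
    rw [hTdef, Finset.mem_erase, Set.Finite.mem_toFinset, Set.mem_setOf_eq, Ideal.dvd_span_singleton]
  have hw₀T : w₀.1 ∉ T := fun h => ((hmemT _).1 h).1 rfl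
  -- the global element `β`
  obtain ⟨β, hβ0, hsq₀, hsqT⟩ := exists_isSquare_mul_algebraMap_and_forall_isSquare F w₀.1 hb T hw₀T
  set β₀ : w₀.1.adicCompletion F := algebraMap F (w₀.1.adicCompletion F) β with hβ₀def
  have hβ₀0 : β₀ ≠ 0 := (map_ne_zero _).2 hβ0
  have hβw0 : ∀ w : HeightOneSpectrum (𝓞 F), algebraMap F (w.adicCompletion F) β ≠ 0 := fun w =>
    (map_ne_zero _).2 hβ0
  have hN0 : Algebra.norm ℚ β ≠ 0 := Algebra.norm_ne_zero_iff.2 hβ0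
  -- (1) the odd-place identity at every `v ∤ 2`
  have hodd : ∀ v : HeightOneSpectrum (𝓞 ℚ), (2 : 𝓞 ℚ) ∉ v.asIdeal →
      (letI := Extension.fintype (𝓞 ℚ) ℚ F (𝓞 F) v
       (∏ w : v.Extension (𝓞 F),
          hilbertSymbol (w.1.adicCompletion F) (q : w.1.adicCompletion F) (algebraMap F (w.1.adicCompletion F) β)) =
        hilbertSymbol (v.adicCompletion ℚ) (q : v.adicCompletion ℚ) (algebraMap ℚ (v.adicCompletion ℚ) (Algebra.norm ℚ β))) := by
    intro v hv2
    letI := Extension.fintype (𝓞 ℚ) ℚ F (𝓞 F) v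
    set p := Rat.HeightOneSpectrum.natGenerator v with hpdef
    haveI hp : Fact p.Prime := ⟨Rat.HeightOneSpectrum.prime_natGenerator v⟩
    have hpv : (p : 𝓞 ℚ) ∈ v.asIdeal := natCast_natGenerator_mem v
    have hp2 : p ≠ 2 := fun h => hv2 (by rw [← Nat.cast_ofNat, ← h]; exact hpv)
    by_cases hpq : p ∣ q
    · -- `p = q`: every `w ∣ v` lies in `T`, so `β` is a square there, and `N β` is a square at `v`
      have hpq' : p = q := (Nat.prime_dvd_prime_iff_eq hp.out hq).1 hpq
      have hsqv : ∀ w : v.Extension (𝓞 F), IsSquare (algebraMap F (w.1.adicCompletion F) β) := by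
        intro w
        refine hsqT w.1 ((hmemT w.1).2 ⟨?_, ?_⟩)
        · intro hww
          have h1 : w.1.under (𝓞 ℚ) = v := w.2
          rw [hww, w₀.2] at h1
          exact hv2 (h1 ▸ hv₂)
        · have hq' : (q : 𝓞 F) ∈ w.1.asIdeal := natCast_mem_of_under_eq w.2 (hpq' ▸ hpv)
          have := Ideal.mul_mem_left w.1.asIdeal (2 : 𝓞 F) hq'
          exact_mod_cast this
      rw [Finset.prod_eq_one (fun w _ => by
        rw [hilbertSymbol_comm]
        exact hilbertSymbol_eq_one_of_isSquare (hsqv w) (hβw0 w.1) _)]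
      rw [hilbertSymbol_comm, hilbertSymbol_eq_one_of_isSquare
        (isSquare_algebraMap_norm_of_forall_isSquare ℚ F v β hsqv) ((map_ne_zero _).2 hN0)]
    · exact prod_hilbertSymbol_natCast_eq_of_not_dvd F hp2 hpq v hpv hβ0
  -- (2) book-keeping: the identity at `v₂`
  have h2 := prod_hilbertSymbol_two_eq_of_forall_odd F hq.pos hβ0 v₂ hv₂ hodd
  letI := Extension.fintype (𝓞 ℚ) ℚ F (𝓞 F) v₂
  -- (3) the left side: only `w₀` contributes
  have hsq2 : ∀ w : v₂.Extension (𝓞 F), w ≠ w₀ → IsSquare (algebraMap F (w.1.adicCompletion F) β) := by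
    intro w hw
    refine hsqT w.1 ((hmemT w.1).2 ⟨fun h => hw (Subtype.ext h), ?_⟩)
    have h2w : (2 : 𝓞 F) ∈ w.1.asIdeal := by exact_mod_cast natCast_mem_of_under_eq w.2 (n := 2) (by exact_mod_cast hv₂)
    have := Ideal.mul_mem_right (q : 𝓞 F) w.1.asIdeal h2w
    exact_mod_cast this
  have hL : (∏ w : v₂.Extension (𝓞 F),
      hilbertSymbol (w.1.adicCompletion F) (q : w.1.adicCompletion F) (algebraMap F (w.1.adicCompletion F) β)) =
      hilbertSymbol (w₀.1.adicCompletion F) (q : w₀.1.adicCompletion F) β₀ := by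
    rw [Finset.prod_eq_single w₀ (fun w _ hw => by
      rw [hilbertSymbol_comm]
      exact hilbertSymbol_eq_one_of_isSquare (hsq2 w hw) (hβw0 w.1) _) (fun h => absurd (Finset.mem_univ _) h)]
  -- `β₀ = b · (c/b)²`
  obtain ⟨c, hc⟩ := hsq₀
  have hc0 : c ≠ 0 := fun h => by
    rw [h, mul_zero] at hc
    exact mul_ne_zero hb hβ₀0 hc
  have hβ₀eq : β₀ = b * (c / b) ^ 2 := by
    field_simp
    linear_combination hc
  have hL' : hilbertSymbol (w₀.1.adicCompletion F) (q : w₀.1.adicCompletion F) β₀ =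
      hilbertSymbol (w₀.1.adicCompletion F) (q : w₀.1.adicCompletion F) b := by
    rw [hβ₀eq, hilbertSymbol_mul_sq_right _ _ (div_ne_zero hc0 hb)]
  -- (4) the right side: `N β = N_{w₀} β₀ · ∏_{w ≠ w₀} N_w β`, the second factor a non-zero square
  have hR := algebraMap_adicCompletion_norm_eq_prod ℚ F v₂ β
  rw [← Finset.mul_prod_erase Finset.univ _ (Finset.mem_univ w₀)] at hR
  have hsqP : IsSquare (∏ w ∈ (Finset.univ.erase w₀ : Finset (v₂.Extension (𝓞 F))),
      Algebra.norm (v₂.adicCompletion ℚ) (algebraMap F (w.1.adicCompletion F) β)) :=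
    Finset.isSquare_prod _ fun w hw => (hsq2 w (Finset.ne_of_mem_erase hw)).map _
  have hP0 : (∏ w ∈ (Finset.univ.erase w₀ : Finset (v₂.Extension (𝓞 F))),
      Algebra.norm (v₂.adicCompletion ℚ) (algebraMap F (w.1.adicCompletion F) β)) ≠ 0 :=
    Finset.prod_ne_zero_iff.2 fun w _ => Algebra.norm_ne_zero_iff.2 (hβw0 w.1)
  obtain ⟨s, hs⟩ := hsqP
  have hs0 : s ≠ 0 := fun h => hP0 (by rw [hs, h, mul_zero])
  have hR' : hilbertSymbol (v₂.adicCompletion ℚ) (q : v₂.adicCompletion ℚ)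
        (algebraMap ℚ (v₂.adicCompletion ℚ) (Algebra.norm ℚ β)) =
      hilbertSymbol (v₂.adicCompletion ℚ) (q : v₂.adicCompletion ℚ) (Algebra.norm (v₂.adicCompletion ℚ) b) := by
    rw [hR, hs, ← sq, hilbertSymbol_mul_sq_right _ _ hs0]
    change hilbertSymbol _ _ (Algebra.norm (v₂.adicCompletion ℚ) β₀) = _
    rw [hβ₀eq, map_mul, map_pow, hilbertSymbol_mul_sq_right _ _
      (Algebra.norm_ne_zero_iff.2 (div_ne_zero hc0 hb))]
  rw [← hL', ← hL, h2, hR']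

/-! ### §2 All non-zero integers `a`: multiplicativity, and `-1 ∼ 7` at dyadic places -/

include hv₂ in
/-- The projection formula for `a = n` a positive natural number, from the prime case by the
bimultiplicativity of the local Hilbert symbol at every place (O'Meara 63:13a, `hilbertSymbol_adicCompletion_mul_left`)
and the multiplicativity of the norm. [cite: Omeara1963, §63B (63:13a)] [cite: NeukirchANT1999, Ch. V (3.1)] -/
theorem hilbertSymbol_natCast_eq_hilbertSymbol_norm {n : ℕ} (hn : n ≠ 0)
    {b : w₀.1.adicCompletion F} (hb : b ≠ 0) :
    hilbertSymbol (w₀.1.adicCompletion F) (n : w₀.1.adicCompletion F) b =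
      hilbertSymbol (v₂.adicCompletion ℚ) (n : v₂.adicCompletion ℚ)
        (Algebra.norm (v₂.adicCompletion ℚ) b) := by
  have hcastF : ∀ m : ℕ, m ≠ 0 → (m : w₀.1.adicCompletion F) ≠ 0 := fun m hm => by
    rw [← map_natCast (algebraMap F (w₀.1.adicCompletion F)) m]
    exact (map_ne_zero _).2 (Nat.cast_ne_zero.2 hm)
  have hcastQ : ∀ m : ℕ, m ≠ 0 → (m : v₂.adicCompletion ℚ) ≠ 0 := fun m hm => by
    rw [← map_natCast (algebraMap ℚ (v₂.adicCompletion ℚ)) m]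
    exact (map_ne_zero _).2 (Nat.cast_ne_zero.2 hm)
  have hNb : Algebra.norm (v₂.adicCompletion ℚ) b ≠ 0 := Algebra.norm_ne_zero_iff.2 hb
  induction n using Nat.recOnMul with
  | zero => exact absurd rfl hn
  | one => simp only [Nat.cast_one, hilbertSymbol_one_left]
  | prime p hp =>
    exact hilbertSymbol_natPrime_eq_hilbertSymbol_norm F v₂ hv₂ w₀ hp hb
  | mul m k ihm ihk =>
    obtain ⟨hm, hk⟩ := Nat.mul_ne_zero_iff.1 hn
    rw [Nat.cast_mul, Nat.cast_mul, hilbertSymbol_adicCompletion_mul_left F w₀.1 (hcastF m hm) (hcastF k hk) hb,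
      hilbertSymbol_adicCompletion_mul_left ℚ v₂ (hcastQ m hm) (hcastQ k hk) hNb, ihm hm, ihk hk]

include hv₂ in
/-- The projection formula for every non-zero INTEGER `a`: the negative case is reduced to the positive one by
`-1 = 7 · (r/7)²` with `r² = -7` (a square at every dyadic place), i.e. `(-n, ·) = (7n, ·)` on both sides.
[cite: Omeara1963, §63A, §63B (63:13a)] [cite: NeukirchANT1999, Ch. V (3.1)] -/
theorem hilbertSymbol_intCast_eq_hilbertSymbol_norm {m : ℤ} (hm : m ≠ 0)
    {b : w₀.1.adicCompletion F} (hb : b ≠ 0) :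
    hilbertSymbol (w₀.1.adicCompletion F) (m : w₀.1.adicCompletion F) b =
      hilbertSymbol (v₂.adicCompletion ℚ) (m : v₂.adicCompletion ℚ)
        (Algebra.norm (v₂.adicCompletion ℚ) b) := by
  have hn0 : m.natAbs ≠ 0 := Int.natAbs_ne_zero.2 hm
  rcases Int.natAbs_eq m with h | h
  · rw [h, Int.cast_natCast, Int.cast_natCast]
    exact hilbertSymbol_natCast_eq_hilbertSymbol_norm F v₂ hv₂ w₀ hn0 hb
  · -- `m = -n`: `(-n, y) = (7 n · (r/7)², y) = (7 n, y)` wherever `-7 = r²`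
    have h2F : (2 : 𝓞 F) ∈ w₀.1.asIdeal := by
      exact_mod_cast natCast_mem_of_under_eq w₀.2 (n := 2) (by exact_mod_cast hv₂)
    have key : ∀ {X : Type} [Field X] (r : X), -7 = r * r → (7 : X) ≠ 0 → ∀ (n : ℕ) (y : X),
        hilbertSymbol X ((-(n : ℤ) : ℤ) : X) y = hilbertSymbol X ((7 * n : ℕ) : X) y := by
      intro X _ r hr h7 n y
      have hr0 : r ≠ 0 := fun h0 => by
        rw [h0, mul_zero] at hr
        exact h7 (by linear_combination (-1 : X) * hr)
      have hcalc : ((-(n : ℤ) : ℤ) : X) = ((7 * n : ℕ) : X) * (r / 7) ^ 2 := by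
        push_cast
        field_simp
        linear_combination (n : X) * hr
      rw [hcalc, hilbertSymbol_mul_sq_left _ _ (div_ne_zero hr0 h7)]
    obtain ⟨rF, hrF⟩ := isSquare_neg_seven_adicCompletion w₀.1 h2F
    obtain ⟨rQ, hrQ⟩ := isSquare_neg_seven_adicCompletion v₂ hv₂
    have h7F : (7 : w₀.1.adicCompletion F) ≠ 0 := by
      rw [← map_ofNat (algebraMap F (w₀.1.adicCompletion F)) 7]
      exact (map_ne_zero _).2 (by norm_num)
    have h7Q : (7 : v₂.adicCompletion ℚ) ≠ 0 := by
      rw [← map_ofNat (algebraMap ℚ (v₂.adicCompletion ℚ)) 7]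
      exact (map_ne_zero _).2 (by norm_num)
    rw [h, key rF hrF h7F, key rQ hrQ h7Q]
    exact hilbertSymbol_natCast_eq_hilbertSymbol_norm F v₂ hv₂ w₀
      (Nat.mul_ne_zero_iff.2 ⟨by norm_num, hn0⟩) hb

end Packet

/-! ### §3 The consumer's currency: `ℚ_[2]` and the canonical `ℚ₂`-algebra structure of `F_𝔭` -/

/-- **The projection (norm-compatibility) formula for the quadratic Hilbert symbol over `ℚ₂`, for COMPLETIONS
of number fields**: for a number field `F`, a dyadic place `𝔭` (with `F_𝔭` a `ℚ₂`-algebra through the unique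
continuous `ℚ₂ → F_𝔭`, `LocalField.adicCompletionPadicAlgebra 𝔭 2 h2`), `a ∈ ℚ₂ˣ` and `b ∈ F_𝔭ˣ`:
`(a, b)_{F_𝔭} = (a, N_{F_𝔭/ℚ₂} b)_{ℚ₂}` — Neukirch IV (6.4) with V (3.1)–(3.2) for `K = F_𝔭`, proved here by the
global road (Hilbert reciprocity) instead of local class field theory.  This is the statement
`HilbertSymbolNormCompatAtTwo` of `HilbertSymbolNormCompat.lean` at `K := 𝔭.adicCompletion F`; the abstract
statement for an arbitrary finite `K/ℚ₂` is not claimed.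
[cite: NeukirchANT1999, Ch. IV (6.4) and Ch. V (3.1)–(3.2); Ch. VI (5.7)] [cite: Omeara1963, §71 Thm. 71:18] -/
theorem hilbertSymbol_normCompat_adicCompletion_two (F : Type) [Field F] [NumberField F]
    (𝔭 : HeightOneSpectrum (𝓞 F)) (h2 : ((2 : ℕ) : 𝓞 F) ∈ 𝔭.asIdeal)
    {a : ℚ_[2]} (ha : a ≠ 0) {b : 𝔭.adicCompletion F} (hb : b ≠ 0) :
    letI := LocalField.adicCompletionPadicAlgebra 𝔭 2 h2
    hilbertSymbol (𝔭.adicCompletion F) (algebraMap ℚ_[2] (𝔭.adicCompletion F) a) b =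
      hilbertSymbol ℚ_[2] a (Algebra.norm ℚ_[2] b) := by
  letI := LocalField.adicCompletionPadicAlgebra 𝔭 2 h2
  -- the dyadic place `v₂` of `ℚ`, and `𝔭` as a place above it
  set v₂ : HeightOneSpectrum (𝓞 ℚ) := (Rat.HeightOneSpectrum.primesEquiv (R := 𝓞 ℚ)).symm ⟨2, Nat.prime_two⟩
    with hv₂def
  have hv₂ : (2 : 𝓞 ℚ) ∈ v₂.asIdeal := by
    exact_mod_cast natCast_mem_primesEquiv_symm ⟨2, Nat.prime_two⟩
  have h𝔭2 : ((2 : ℕ) : 𝓞 ℚ) ∈ (𝔭.under (𝓞 ℚ)).asIdeal := by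
    change ((2 : ℕ) : 𝓞 ℚ) ∈ Ideal.comap (algebraMap (𝓞 ℚ) (𝓞 F)) 𝔭.asIdeal
    rw [Ideal.mem_comap, map_natCast]
    exact h2
  have h𝔭 : 𝔭.under (𝓞 ℚ) = v₂ :=
    rat_place_eq_of_natCast_mem Nat.prime_two h𝔭2 (by exact_mod_cast hv₂)
  -- replace `𝔭` by `w₀.1`, `w₀ : v₂.Extension (𝓞 F)` (the packet's `ℚ_{v₂}`-algebra structure is keyed on `w₀.1`)
  obtain ⟨w₀, hw₀⟩ : ∃ w₀ : v₂.Extension (𝓞 F), w₀.1 = 𝔭 := ⟨⟨𝔭, h𝔭⟩, rfl⟩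
  subst hw₀
  -- `e : ℚ_[2] ≃ ℚ_{v₂}`, and the canonical structure map `ℚ_[2] → F_𝔭` is `(ℚ_{v₂} → F_{w₀}) ∘ e`
  let e : ℚ_[2] ≃A[ℚ] v₂.adicCompletion ℚ := Padic.adicCompletionEquiv (𝓞 ℚ) ⟨2, Nat.prime_two⟩
  have hcomp : (algebraMap (v₂.adicCompletion ℚ) (w₀.1.adicCompletion F)).comp e.toRingEquiv.toRingHom =
      algebraMap ℚ_[2] (w₀.1.adicCompletion F) := by
    have hcont : Continuous
        ((algebraMap (v₂.adicCompletion ℚ) (w₀.1.adicCompletion F)).comp e.toRingEquiv.toRingHom) :=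
      (w₀.adicCompletionSemialgHom_continuous ℚ F).comp e.continuous
    exact LocalField.eq_algebraMap_adicCompletionPadicAlgebra w₀.1 2 h2 _ hcont
  have halg : ∀ r : ℚ_[2], algebraMap ℚ_[2] (w₀.1.adicCompletion F) r =
      algebraMap (v₂.adicCompletion ℚ) (w₀.1.adicCompletion F) (e r) := fun r =>
    (RingHom.congr_fun hcomp r).symm
  -- norms: `e (N_{F_𝔭/ℚ_[2]} b) = N_{F_{w₀}/ℚ_{v₂}} b`
  have hnorm : e (Algebra.norm ℚ_[2] b) = Algebra.norm (v₂.adicCompletion ℚ) b :=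
    Algebra.norm_eq_of_ringEquiv e.toRingEquiv hcomp b
  -- transport the right-hand symbol along `e`
  rw [← hilbertSymbol_map_ringEquiv e.toRingEquiv a (Algebra.norm ℚ_[2] b)]
  change hilbertSymbol (w₀.1.adicCompletion F) (algebraMap ℚ_[2] (w₀.1.adicCompletion F) a) b =
    hilbertSymbol (v₂.adicCompletion ℚ) (e a) (e (Algebra.norm ℚ_[2] b))
  rw [hnorm, halg a]
  -- square class of `a`: `a = m s²`, `m ∈ ℤ ∖ 0`
  obtain ⟨m, s, hm, hs, has⟩ := padic_exists_intCast_mul_sq a ha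
  have hes : e s ≠ 0 := (map_ne_zero _).2 hs
  have heas : e a = (m : v₂.adicCompletion ℚ) * (e s) ^ 2 := by
    rw [has, map_mul, map_pow, map_intCast]
  rw [heas, map_mul, map_pow, map_intCast,
    hilbertSymbol_mul_sq_left _ _ ((map_ne_zero _).2 hes), hilbertSymbol_mul_sq_left _ _ hes]
  exact hilbertSymbol_intCast_eq_hilbertSymbol_norm F v₂ hv₂ w₀ hm hb

end Literature.NumberTheory.QuadraticForms
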